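import Summits.ResolutionOfSingularities.ResolutionOfSingularities.Theorems.WeightedInvariantHypersurfaceCentreChoiceToDatum
import Summits.ResolutionOfSingularities.ResolutionOfSingularities.Theorems.WeightedInvariantTermination
import Summits.ResolutionOfSingularities.ResolutionOfSingularities.Theorems.WeightedInvariantSingularLocusHomogeneous
import Literature.AlgebraicGeometry.Resolution.SmoothStalksRegular
import Literature.AlgebraicGeometry.Resolution.Principalization
import Literature.AlgebraicGeometry.Resolution.MarkedIdeals
import HarnessLib

/-!
# The maximum stratum of a pointwise invariant along a locally principal hypersurface

Route `ResolutionOfSingularities/WeightedInvariant`, crux `Theses.WeightedInvariant.HypersurfaceCentreConstruction`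
(stmt-ResolutionOfSingularities-19897), door line `local-engine`, H2c″ ASSEMBLY (stub-9 = res-D-brk-1's sketch
`door_assembly_eft3_v1.lean`, sub-stub **[S1] `stub_maxLocus`**; res-L1-w43-plan-1 ORDER (o14)(B)).

The assembly reads the local engine's invariant `ι : (R : Type) → [CommRing R] → R → Ordinal` at a point `y` of the
smooth ambient `Y` on a LOCAL EQUATION of the locally principal hypersurface ideal `X`: `y ↦ ι(𝒪_{Y,y}, g_y)` with
`X_y = (g_y)`.  This file proves, DEF-FREE (for ANY family of stalk generators `g`, so that it serves whichever pointwise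
definition the assembly lands — stub-9's `localGenerator`/`iotaAt`/`iotaMax`/`maxLocus` are the instance
`g := localGenerator X`):

* `isClosed_singImage` — the image in `Y` of the non-regular locus of `V(X)` is closed, for `Y` locally of finite type
  over a field (the tree theorem `isClosed_singSet` of `WeightedInvariantSingularLocusHomogeneous`, restated in the
  `singImage` vocabulary; regular locus open by Matsumura, Cor. to Thm. 30.5);
* `isClosed_superlevel_iota_of_stalkGenerators` — from the clause bodies (c6) «`ι` is invariant under ring isomorphisms»,
  (c8) «superlevel sets of `y ↦ ι(𝒪_{Y,y}, f_y)` are closed for a GLOBAL section `f` of a smooth quasi-compact scheme over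
  a field» and (TP4/c12a) «`ι` is blind to unit factors», every superlevel set `{y | α ≤ ι(𝒪_{Y,y}, g_y)}` is closed:
  closedness is local, and on a principal affine chart `(U, f_U)` of `X` the generator `g_y` is a unit multiple of the
  germ of `f_U`, whose `ι` is read through the stalk isomorphism of the open subscheme `U`;
* `exists_isMaxOn_of_isClosed_superlevel` / `isClosed_setOf_eq_iSup` — on a Noetherian space an ordinal function with
  closed superlevel sets attains its supremum on any non-empty subset `S`, and `{y ∈ S | v y = ⨆_S v}` is closed when
  `S` is (tree core `Literature.AlgGeom.exists_max_of_isClosed_superlevel` on the subspace `S`);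
* `isClosed_iotaMaxLocus_of_stalkGenerators` — **[S1] in def-free form**: for a smooth quasi-compact `Y` over a field
  and a locally principal `X` with `V(X)` not regular, the maximum locus
  `{y ∈ singImage X | ι(𝒪_{Y,y}, g_y) = ⨆_{singImage X} ι}` is closed, non-empty and inside `singImage X`.

Nothing here is a claim about resolution of singularities in characteristic `p`: the clauses (c6)/(c8)/(TP4) enter as
HYPOTHESES on an arbitrary `ι`; no `LocalWeightedDropEFT3`-type statement is asserted.  AI-written; weaker than expert
review.
-/

noncomputable section

open CategoryTheory AlgebraicGeometry TopologicalSpace IsLocalRing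
open Literature.AlgebraicGeometry.Resolution

set_option linter.dupNamespace false -- mandated namespace of this single-conjunct summit

namespace Summit.ResolutionOfSingularities.ResolutionOfSingularities.Theorems

universe u

/-! ## The image of the non-regular locus is closed -/

/-- **`singImage X` is closed** when `Y` is locally of finite type over a field — the tree theorem
`isClosed_singSet` (res-type-025: regular locus of the finite-type `k`-scheme `V(X)` open by Matsumura, Cor. to
Thm. 30.5, `isOpen_regularLocus_of_locallyOfFiniteType_field`; `V(X) ↪ Y` a closed embedding) in the `singImage`
vocabulary of the door files. [folklore] -/
theorem isClosed_singImage {k : Type} [Field k] {Y : Scheme.{0}} (f : Y ⟶ Spec (.of k))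
    [LocallyOfFiniteType f] (X : Y.IdealSheafData) : IsClosed (singImage X) :=
  isClosed_singSet f X

/-- `singImage X` is non-empty exactly when `V(X)` is not regular. [folklore] -/
theorem singImage_nonempty_iff {Y : Scheme.{0}} (X : Y.IdealSheafData) :
    (singImage X).Nonempty ↔ ¬ Scheme.IsRegular X.subscheme := by
  constructor
  · rintro ⟨y, x, -, hx⟩ hreg
    exact hx (hreg x)
  · intro h
    obtain ⟨x, hx⟩ := not_forall.mp h
    exact ⟨X.subschemeι x, x, rfl, hx⟩

/-! ## Superlevel sets of `ι` on local equations are closed -/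

section Superlevel

variable (ι : (R : Type) → [CommRing R] → R → Ordinal.{0})

/-- In a local equation chart, any two generators of the stalk ideal have the same `ι` (unit invariance):
if `X_y = (g)` and `X_y = (h)` in the domain `𝒪_{Y,y}` then `ι(𝒪_{Y,y}, g) = ι(𝒪_{Y,y}, h)`. [folklore] -/
theorem iota_eq_of_span_singleton_eq
    (hu : ∀ (R : Type) [CommRing R] (v : Rˣ) (g : R), ι R ((v : R) * g) = ι R g)
    {R : Type} [CommRing R] [IsDomain R] {g h : R} (hgh : Ideal.span {g} = Ideal.span {h}) :
    ι R g = ι R h := by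
  obtain ⟨v, hv⟩ := Ideal.span_singleton_eq_span_singleton.mp hgh
  rw [← hv, mul_comm, hu]

/-- **Superlevel sets of `ι` along a locally principal ideal sheaf are closed.**  Let `Y` be smooth over a field `k`,
`X` a locally principal ideal sheaf on `Y`, and `g_y` (`y ∈ Y`) generators of the stalks `X_y`.  If `ι` is invariant
under ring isomorphisms (c6), has closed superlevel sets on global sections of smooth quasi-compact schemes over fields
(c8), and is blind to unit factors (TP4), then `{y | α ≤ ι(𝒪_{Y,y}, g_y)}` is closed for every `α`: on a principal
affine chart `(U, f_U)` of `X`, `g_y` is a unit multiple of the germ of `f_U`, and the `ι` of that germ is the `ι` of the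
germ of the global section `f_U|_U` of the smooth quasi-compact `k`-scheme `U`, read through `𝒪_{U,y} ≅ 𝒪_{Y,y}`.
[folklore] -/
theorem isClosed_superlevel_iota_of_stalkGenerators
    (hc6 : ∀ (R T : Type) [CommRing R] [CommRing T] (e : R ≃+* T) (g : R), ι T (e g) = ι R g)
    (hc8 : ∀ (k₀ : Type) [Field k₀] (Z : Scheme.{0}) (hZ : Z ⟶ Spec (CommRingCat.of k₀)) [Smooth hZ]
      [QuasiCompact hZ] (s : Γ(Z, ⊤)) (α : Ordinal.{0}),
      IsClosed {z : ↥Z | α ≤ ι (Z.presheaf.stalk z) (Z.presheaf.germ ⊤ z trivial s)})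
    (hu : ∀ (R : Type) [CommRing R] (v : Rˣ) (g : R), ι R ((v : R) * g) = ι R g)
    {k : Type} [Field k] {Y : Scheme.{0}} (f : Y ⟶ Spec (.of k)) [Smooth f]
    (X : Y.IdealSheafData) (hX : IsLocallyPrincipal X)
    (g : ∀ y : Y, Y.presheaf.stalk y) (hg : ∀ y, stalkIdeal X y = Ideal.span {g y}) (α : Ordinal.{0}) :
    IsClosed {y : Y | α ≤ ι (Y.presheaf.stalk y) (g y)} := by
  classical
  -- principal affine charts of `X`, one through every point
  choose U hyU fU hfU using hX
  have hcov : IsOpenCover (fun y : Y => ((U y : Y.Opens))) := by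
    refine IsOpenCover.mk (top_le_iff.mp fun y _ => ?_)
    exact Opens.mem_iSup.mpr ⟨y, hyU y⟩
  rw [hcov.isClosed_iff_coe_preimage]
  intro y₀
  -- the chart `V := U y₀` as a smooth quasi-compact `k`-scheme
  set V : Y.Opens := (U y₀ : Y.Opens) with hVdef
  have hVaff : IsAffineOpen V := (U y₀).2
  haveI : IsAffine (V : Scheme.{0}) := hVaff
  haveI : QuasiCompact (V.ι ≫ f) :=
    (HasAffineProperty.iff_of_isAffine (P := @QuasiCompact)).mpr (inferInstance : CompactSpace _)
  -- the local equation, as a global section of the chart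
  have hle : V.ι ''ᵁ ⊤ ≤ V := le_of_eq V.ι_image_top
  let s : Γ(V, ⊤) := Y.presheaf.map (homOfLE hle).op (fU y₀)
  have hC := hc8 k V (V.ι ≫ f) s α
  have hEq : (Subtype.val ⁻¹' {y : Y | α ≤ ι (Y.presheaf.stalk y) (g y)} : Set (U y₀ : Y.Opens)) =
      {u : ↥(V : Scheme.{0}) | α ≤ ι ((V : Scheme.{0}).presheaf.stalk u)
        ((V : Scheme.{0}).presheaf.germ ⊤ u trivial s)} := by
    ext u
    simp only [Set.mem_preimage, Set.mem_setOf_eq]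
    -- compare the two `ι`-values at the point `u` of the chart
    suffices h : ι (Y.presheaf.stalk u.1) (g u.1) =
        ι ((V : Scheme.{0}).presheaf.stalk u) ((V : Scheme.{0}).presheaf.germ ⊤ u trivial s) by
      rw [h]
      exact Iff.rfl
    -- (c6): read the germ of `s` on `V` in `𝒪_{Y,u}` through the stalk isomorphism
    have h6 := hc6 _ _ (V.stalkIso u).commRingCatIsoToRingEquiv ((V : Scheme.{0}).presheaf.germ ⊤ u trivial s)
    have hgerm : (V.stalkIso u).commRingCatIsoToRingEquiv ((V : Scheme.{0}).presheaf.germ ⊤ u trivial s) =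
        Y.presheaf.germ V u.1 u.2 (fU y₀) := by
      change (V.stalkIso u).hom ((V : Scheme.{0}).presheaf.germ ⊤ u trivial s) = _
      rw [← CommRingCat.comp_apply, Scheme.Opens.germ_stalkIso_hom]
      exact TopCat.Presheaf.germ_res_apply Y.presheaf (homOfLE hle) u.1 ⟨u, trivial, rfl⟩ (fU y₀)
    rw [hgerm] at h6
    rw [← h6]
    -- (TP4): `g_u` and the germ of `f_U` generate the same ideal `X_u` of the domain `𝒪_{Y,u}`
    haveI : IsRegularLocalRing (Y.presheaf.stalk u.1) := isRegularLocalRing_stalk_of_smooth_of_field f u.1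
    haveI : IsDomain (Y.presheaf.stalk u.1) := isDomain_of_isRegularLocalRing _
    apply iota_eq_of_span_singleton_eq ι hu
    rw [← hg u.1, stalkIdeal_eq_map_germ X (U y₀) u.2, hfU y₀, Ideal.map_span, Set.image_singleton]
  show IsClosed ((Subtype.val ⁻¹' {y : Y | α ≤ ι (Y.presheaf.stalk y) (g y)} : Set (U y₀ : Y.Opens)))
  rw [hEq]
  exact hC

end Superlevel

/-! ## Maxima of functions with closed superlevel sets on subsets of a Noetherian space -/

section Max

variable {Z : Type} [TopologicalSpace Z]

/-- On a Noetherian space, an ordinal function all of whose superlevel sets are closed attains its maximum on every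
non-empty subset (the subset is again Noetherian; tree core `exists_max_of_isClosed_superlevel`). [folklore] -/
theorem exists_isMaxOn_of_isClosed_superlevel [NoetherianSpace Z] (v : Z → Ordinal.{0})
    (hv : ∀ α, IsClosed {z | α ≤ v z}) {S : Set Z} (hS : S.Nonempty) :
    ∃ z₀ ∈ S, ∀ z ∈ S, v z ≤ v z₀ := by
  haveI : Nonempty S := hS.to_subtype
  obtain ⟨z₀, hz₀⟩ := Literature.AlgGeom.exists_max_of_isClosed_superlevel (fun z : S => v z.1)
    (fun α => (hv α).preimage continuous_subtype_val)
  exact ⟨z₀.1, z₀.2, fun z hz => hz₀ ⟨z, hz⟩⟩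

omit [TopologicalSpace Z] in
/-- The supremum over `S` of such a function is attained: it is the value at a maximum point. [folklore] -/
theorem iSup_eq_of_isMaxOn (v : Z → Ordinal.{0}) {S : Set Z} {z₀ : Z} (hz₀ : z₀ ∈ S)
    (hmax : ∀ z ∈ S, v z ≤ v z₀) : (⨆ z : S, v z.1) = v z₀ :=
  le_antisymm (Ordinal.iSup_le fun z => hmax z.1 z.2) (Ordinal.le_iSup (fun z : S => v z.1) ⟨z₀, hz₀⟩)

/-- **The maximum locus on a closed subset is closed and non-empty.**  On a Noetherian space, for an ordinal function
`v` with closed superlevel sets and a closed non-empty `S`, the set `{z ∈ S | v z = ⨆_S v}` is closed, non-empty, and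
(trivially) contained in `S`. [folklore] -/
theorem isClosed_setOf_eq_iSup [NoetherianSpace Z] (v : Z → Ordinal.{0}) (hv : ∀ α, IsClosed {z | α ≤ v z})
    {S : Set Z} (hSc : IsClosed S) (hS : S.Nonempty) :
    IsClosed {z | z ∈ S ∧ v z = ⨆ z' : S, v z'.1} ∧ {z | z ∈ S ∧ v z = ⨆ z' : S, v z'.1}.Nonempty ∧
      {z | z ∈ S ∧ v z = ⨆ z' : S, v z'.1} ⊆ S := by
  obtain ⟨z₀, hz₀, hmax⟩ := exists_isMaxOn_of_isClosed_superlevel v hv hS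
  have hsup : (⨆ z' : S, v z'.1) = v z₀ := iSup_eq_of_isMaxOn v hz₀ hmax
  have hset : {z | z ∈ S ∧ v z = ⨆ z' : S, v z'.1} = S ∩ {z | v z₀ ≤ v z} := by
    ext z
    simp only [Set.mem_setOf_eq, Set.mem_inter_iff, hsup]
    constructor
    · rintro ⟨hz, heq⟩
      exact ⟨hz, heq.ge⟩
    · rintro ⟨hz, hge⟩
      exact ⟨hz, le_antisymm (hmax z hz) hge⟩
  refine ⟨?_, ⟨z₀, hz₀, hsup.symm⟩, fun z hz => hz.1⟩
  rw [hset]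
  exact hSc.inter (hv _)

end Max

/-! ## [S1]: the maximum stratum of `ι` over the non-regular locus -/

/-- A smooth quasi-compact scheme over a field has a Noetherian underlying space. [folklore] -/
theorem noetherianSpace_of_smooth_quasiCompact {k : Type u} [Field k] {Y : Scheme.{u}}
    (f : Y ⟶ Spec (.of k)) [Smooth f] [QuasiCompact f] : NoetherianSpace Y := by
  haveI : IsLocallyNoetherian Y := LocallyOfFiniteType.isLocallyNoetherian f
  haveI : CompactSpace Y := QuasiCompact.compactSpace_of_compactSpace f
  haveI : IsNoetherian Y := {}
  infer_instance

/-- **[S1] (def-free form): the maximum stratum of `ι` over the non-regular locus is closed, non-empty and inside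
the non-regular locus.**  `Y` smooth quasi-compact over a field `k`, `X` a locally principal ideal sheaf with `V(X)`
not regular, `g_y` generators of the stalks `X_y`, `ι` satisfying (c6) iso-invariance, (c8) upper semicontinuity on
global sections of smooth quasi-compact schemes over fields, (TP4) unit invariance.  Then
`M = {y ∈ singImage X | ι(𝒪_{Y,y}, g_y) = ⨆_{singImage X} ι}` is closed, non-empty, `⊆ singImage X`: the superlevel
sets are closed (`isClosed_superlevel_iota_of_stalkGenerators`), `singImage X` is closed (`isClosed_singImage`) and
non-empty, and `|Y|` is Noetherian.  stub-9's `stub_maxLocus` is the instance `g := localGenerator X`. [folklore] -/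
theorem isClosed_iotaMaxLocus_of_stalkGenerators (ι : (R : Type) → [CommRing R] → R → Ordinal.{0})
    (hc6 : ∀ (R T : Type) [CommRing R] [CommRing T] (e : R ≃+* T) (g : R), ι T (e g) = ι R g)
    (hc8 : ∀ (k₀ : Type) [Field k₀] (Z : Scheme.{0}) (hZ : Z ⟶ Spec (CommRingCat.of k₀)) [Smooth hZ]
      [QuasiCompact hZ] (s : Γ(Z, ⊤)) (α : Ordinal.{0}),
      IsClosed {z : ↥Z | α ≤ ι (Z.presheaf.stalk z) (Z.presheaf.germ ⊤ z trivial s)})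
    (hu : ∀ (R : Type) [CommRing R] (v : Rˣ) (g : R), ι R ((v : R) * g) = ι R g)
    {k : Type} [Field k] {Y : Scheme.{0}} (f : Y ⟶ Spec (.of k)) [Smooth f] [QuasiCompact f]
    (X : Y.IdealSheafData) (hX : IsLocallyPrincipal X) (hsing : ¬ Scheme.IsRegular X.subscheme)
    (g : ∀ y : Y, Y.presheaf.stalk y) (hg : ∀ y, stalkIdeal X y = Ideal.span {g y}) :
    IsClosed {y | y ∈ singImage X ∧ ι (Y.presheaf.stalk y) (g y) =
        ⨆ y' : singImage X, ι (Y.presheaf.stalk y'.1) (g y'.1)} ∧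
      {y | y ∈ singImage X ∧ ι (Y.presheaf.stalk y) (g y) =
        ⨆ y' : singImage X, ι (Y.presheaf.stalk y'.1) (g y'.1)}.Nonempty ∧
      {y | y ∈ singImage X ∧ ι (Y.presheaf.stalk y) (g y) =
        ⨆ y' : singImage X, ι (Y.presheaf.stalk y'.1) (g y'.1)} ⊆ singImage X := by
  haveI : NoetherianSpace Y := noetherianSpace_of_smooth_quasiCompact f
  exact isClosed_setOf_eq_iSup (fun y => ι (Y.presheaf.stalk y) (g y))
    (isClosed_superlevel_iota_of_stalkGenerators ι hc6 hc8 hu f X hX g hg) (isClosed_singImage f X)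
    ((singImage_nonempty_iff X).mpr hsing)

/-- **[S1], maximum-point form**: under the same hypotheses some point `y₀ ∈ singImage X` maximises
`y ↦ ι(𝒪_{Y,y}, g_y)` over `singImage X`. [folklore] -/
theorem exists_isMaxOn_iota_singImage (ι : (R : Type) → [CommRing R] → R → Ordinal.{0})
    (hc6 : ∀ (R T : Type) [CommRing R] [CommRing T] (e : R ≃+* T) (g : R), ι T (e g) = ι R g)
    (hc8 : ∀ (k₀ : Type) [Field k₀] (Z : Scheme.{0}) (hZ : Z ⟶ Spec (CommRingCat.of k₀)) [Smooth hZ]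
      [QuasiCompact hZ] (s : Γ(Z, ⊤)) (α : Ordinal.{0}),
      IsClosed {z : ↥Z | α ≤ ι (Z.presheaf.stalk z) (Z.presheaf.germ ⊤ z trivial s)})
    (hu : ∀ (R : Type) [CommRing R] (v : Rˣ) (g : R), ι R ((v : R) * g) = ι R g)
    {k : Type} [Field k] {Y : Scheme.{0}} (f : Y ⟶ Spec (.of k)) [Smooth f] [QuasiCompact f]
    (X : Y.IdealSheafData) (hX : IsLocallyPrincipal X) (hsing : ¬ Scheme.IsRegular X.subscheme)
    (g : ∀ y : Y, Y.presheaf.stalk y) (hg : ∀ y, stalkIdeal X y = Ideal.span {g y}) :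
    ∃ y₀ ∈ singImage X, ∀ y ∈ singImage X, ι (Y.presheaf.stalk y) (g y) ≤ ι (Y.presheaf.stalk y₀) (g y₀) := by
  haveI : NoetherianSpace Y := noetherianSpace_of_smooth_quasiCompact f
  exact exists_isMaxOn_of_isClosed_superlevel (fun y => ι (Y.presheaf.stalk y) (g y))
    (isClosed_superlevel_iota_of_stalkGenerators ι hc6 hc8 hu f X hX g hg) ((singImage_nonempty_iff X).mpr hsing)

end Summit.ResolutionOfSingularities.ResolutionOfSingularities.Theorems

end
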